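/-
Copyright (c) 2026 the pub-hodgecm-mathlib formalisation cell (harness21).  Prover seat hodgecm-mathlib-A-p03 (g25); road «R1LL-tree» (architect A-p16 (g27), RULINGS A-2 (b) ∕ A-3 (a) ∕ A-8 (d);
LEAD F0P3a-plan (g10) T9-8), brick I-5a FILE B «compact elements stabilise a vertex lattice», 2026-09-01.
-/
import Literature.NumberTheory.Automorphic.UnitarySplitTorusSelfDualVertex              -- ★ I-5a FILE A (this seat): eigenframe Gram identities, split torus, `GL₂(𝒪)` bookkeeping
import Literature.NumberTheory.Automorphic.SelfDualLatticeCountCyclicFrameCM            -- ★ type-(2) cyclic frame at `w` (β0′), `v_eq_iff_valuation_eq`, `placeForm_antidiagOne`, `antidiagOne_eq_over`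
import Literature.NumberTheory.Automorphic.RankTwoEigenframeOfSplitCharpoly               -- ★ `exists_eigenframe_of_isRoot_of_separable`, `exists_eq_X_sub_C_mul_X_sub_C_of_isRoot`
import Literature.NumberTheory.Automorphic.PlaneLatticesCompanionSelfDualStrata           -- ★ `exists_valuation_eq_valuation_zpow`, `zpow_uniformizer_mem_integer_iff`
import Literature.NumberTheory.Automorphic.UnitaryGroupModularLocusCM                     -- ★ F0P2-p02 (g9): the `e = 1` colour `exists_eq_mul_mul_inv_of_modular_antidiagTwo` (+ ★ self-dual locus, `map_span_range_transpose_eq_self_iff`)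
import Literature.NumberTheory.Rogawski1990.LocalStableClassesRankTwoCompactSideCount      -- ★ `map_mul_self_eq_one_iff_of_eigenframe` (norm-one eigenvalues come in pairs)
import Literature.LinearAlgebra.HermitianPlaneIsotropicLinesFinite                        -- ★ B-p08 `form_eq_zero_of_unitary_transvection`
import HarnessLib

/-!
# Compact elements of `U(Φ₂)(L⁺_v)` stabilise a VERTEX lattice (I-5a, FILE B)

Every `γ ∈ U(σ_w, (Φ₂)_w)(L_w)` with integral trace fixes a self-dual or a `ϖ`-modular lattice (Bruhat–Tits for the quasi-split `U(1,1)` at an unramified non-split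
place: the compact elements are the union of the stabilisers of the vertices of the tree, of BOTH colours; [Kottwitz1988, §2], [Rogawski1990, §3.6, §4.9], [Serre1980Trees,
Ch. II §1]).  FILE A = ★ `UnitarySplitTorusSelfDualVertex` (eigenframe Gram identities, the split torus, `GL₂(𝒪)` bookkeeping).  Topic `NumberTheory/Automorphic`;
namespaces `Literature.NumberTheory.Automorphic` (§3) and `….UnitaryGroup` (§4).  THEOREMS ONLY (no definition ∕ instance ∕ notation ∕ named fact ∕ `sorry`); kernel lane.
Cell `pub/hodgecm-mathlib`, F0∕P3a, road «R1LL-tree» (architect A-p16 (g27) RULINGS A-2 (b), A-3 (a), A-8 (d)); HONEST LABEL: HC_CM is proved only modulo the printed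
citations until rung 0 closes — this file is elementary linear algebra over ★ frames.  TOKENS (★ `glInt` ∕ `formCongr` world, no dual-lattice object): `Λ(g)` is a VERTEX
iff `∃ e ≤ 1, ∃ J′ ∈ glInt 2 K, ϖ ^ e • ↑J′ = formCongr σ g J` (`e = 0` self-dual, `e = 1` `ϖ`-modular); `γ · Λ(g) = Λ(g)` iff `g⁻¹ γ g ∈ glInt 2 K`.
* §3 (any discretely valued `K`, `σ` an involution fixing the uniformizer `ϖ`) THE UNITARY TRANSVECTION `γ = c • 1 + n`, `n² = 0`: its kernel line is isotropic (★ B-p08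
  `form_eq_zero_of_unitary_transvection`), the hyperbolic partner is `e₀` or `e₁`, and the basis `(ϖ^{−k} v₀, ϖ^k w)` has Gram `Φ₂` with `γ` integral for `k ≫ 0`
  (**`exists_formCongr_eq_and_mem_glInt_of_mul_self_eq_zero`**); THE DOUBLE ROOT `χ_γ = (X − α)²` (Cayley–Hamilton: **`exists_formCongr_eq_and_mem_glInt_of_not_separable`**).
* §4 AT THE CM PLACE `w` (`v` non-split, unramified): **`exists_vertexFrame_of_trace_mem`** — `tr γ ∈ 𝒪_w ⟹ ∃ g e, e ≤ 1 ∧ (∃ J′ ∈ glInt 2 L_w, ϖ_w^e • ↑J′ = formCongr σ_w g (Φ₂)_w)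
  ∧ g⁻¹ γ g ∈ glInt 2 L_w`, by the trichotomy of `χ_γ` over `L_w`: no root ⇒ ★ cyclic frame (β0′); distinct norm-one roots ⇒ ★ eigenframe + ★ (L5-d1) rescaling; distinct
  roots not of norm one ⇒ FILE A split torus; double root ⇒ §3.  COROLLARIES: the lattice spelling `exists_vertexLattice_map_eq_self_of_trace_mem`; the `e = 0` colour in
  group currency `exists_eq_mul_mul_inv_of_selfDual_antidiagTwo` (★ `exists_mem_unitaryGroupOfForm_mul_of_selfDual_of_nonsplit`); and the SUPPORT LOCALISATION on the carrier
  `U = ↥ShimuraVarieties.unitaryGroup σ_w (Φ₂)_w`: **`exists_eq_mul_mul_inv_or_of_trace_mem`** — `γ = y k y⁻¹` with `k ∈ K⁰ := GL₂(𝒪_w) ⊓ U` or `k ∈ K¹ :=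
  (diag(1, ϖ_w) GL₂(𝒪_w) diag(1, ϖ_w)⁻¹) ⊓ U` (the `e = 1` colour is ★ F0P2-p02 `exists_eq_mul_mul_inv_of_modular_antidiagTwo`).

References: [Kottwitz1988] R. E. Kottwitz, *Tamagawa numbers*, Ann. of Math. 127 (1988), §2; [Rogawski1990] J. D. Rogawski, *Automorphic Representations of Unitary Groups
in Three Variables* (1990), §3.5 p. 29, §3.6 p. 31, §4.9 Lemma 4.9.3 p. 61, §12.6 p. 174; [Serre1980Trees] J.-P. Serre, *Trees* (1980), Ch. II §1.1–§1.3; [Jacobowitz1962]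
R. Jacobowitz, *Hermitian forms over local fields*, Amer. J. Math. 84 (1962), §7; [Flicker1998UnitaryFL] Y. Z. Flicker, *The unitary fundamental lemma*, §6 p. 97.
-/

set_option autoImplicit false

noncomputable section

open scoped ValuativeRel Matrix MatrixGroups
open Matrix ValuativeRel NumberField IsDedekindDomain
open Literature.AlgebraicGeometry.ShimuraVarieties (unitaryGroup mem_unitaryGroup_iff)

namespace Literature.NumberTheory.Automorphic

variable {K : Type*} [Field K] (σ : K →+* K)

/-! ## §3 The self-dual (`e = 0`) frames over a discretely valued field: the unitary transvection and the double root -/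

section Vertex

variable [ValuativeRel K] {ϖ : K} (hϖ : IsUniformizingElement ϖ)

include hϖ in
/-- **A UNITARY TRANSVECTION (OR SCALAR) FIXES A SELF-DUAL VERTEX.**  `γ ∈ U(σ, Φ₂)`, `↑γ = c • 1 + n`, `n² = 0`, `|c| = 1` (`σ` an involution fixing the uniformizer `ϖ`,
`𝒪` a DVR) ⟹ `∃ g, ᵗσ(g) Φ₂ g = Φ₂ ∧ g⁻¹ γ g ∈ GL₂(𝒪)`: `g = 1` if `n = 0`; else the kernel line `v₀` of `n` is isotropic (★ B-p08), its hyperbolic partner is a rescaled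
standard vector, and `g = (v₀ | w) · diag(ϖ^{−k}, ϖ^k)`, `k ≫ 0`. [cite: Serre1980Trees, Ch. II §1.3] [cite: Rogawski1990, §12.6 p. 174] [cite: Flicker1998UnitaryFL, §6 p. 97] -/
theorem exists_formCongr_eq_and_mem_glInt_of_mul_self_eq_zero [IsDiscreteValuationRing 𝒪[K]] (hσσ : ∀ x, σ (σ x) = x) (hσϖ : σ ϖ = ϖ)
    {γ : GL (Fin 2) K} (hγ : γ ∈ unitaryGroup σ (Matrix.of fun i j : Fin 2 => if i.val + j.val + 1 = 2 then (1 : K) else 0))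
    {c : K} (hc : valuation K c = 1) {n : Matrix (Fin 2) (Fin 2) K} (hn2 : n * n = 0)
    (hγn : (γ : Matrix (Fin 2) (Fin 2) K) = c • (1 : Matrix (Fin 2) (Fin 2) K) + n) :
    ∃ g : GL (Fin 2) K, formCongr σ g (Matrix.of fun i j : Fin 2 => if i.val + j.val + 1 = 2 then (1 : K) else 0) =
        (Matrix.of fun i j : Fin 2 => if i.val + j.val + 1 = 2 then (1 : K) else 0) ∧ g⁻¹ * γ * g ∈ glInt 2 K := by
  classical
  have hϖ0 : ϖ ≠ 0 := hϖ.ne_zero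
  have hcO : c ∈ 𝒪[K] := (Valuation.mem_integer_iff _ _).2 hc.le
  rcases eq_or_ne n 0 with hn | hn
  · refine ⟨1, by rw [formCongr, Units.val_one, Matrix.map_one σ (map_zero σ) (map_one σ), transpose_one, Matrix.one_mul, Matrix.mul_one], ?_⟩
    rw [inv_one, one_mul, mul_one]
    refine mem_glInt_of_isIntegralMatrix (fun i j => ?_) ?_
    · rw [hγn, hn, add_zero, Matrix.smul_apply, smul_eq_mul]
      rcases eq_or_ne i j with rfl | hij
      · rw [Matrix.one_apply_eq, mul_one]
        exact hcO
      · rw [Matrix.one_apply_ne hij, mul_zero]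
        exact (𝒪[K]).zero_mem
    · rw [hγn, hn, add_zero, Matrix.det_smul, Matrix.det_one, mul_one, Fintype.card_fin, map_pow, hc, one_pow]
  · obtain ⟨i₀, j₀, hij₀⟩ : ∃ i j, n i j ≠ 0 := by
      by_contra h
      push Not at h
      exact hn (Matrix.ext fun i j => h i j)
    obtain ⟨v₀, hv₀e⟩ : ∃ v₀ : Fin 2 → K, v₀ = fun i => n i j₀ := ⟨_, rfl⟩
    have hv₀ : v₀ ≠ 0 := fun h0 => hij₀ (by
      have h := congrFun h0 i₀
      rw [hv₀e] at h
      exact h)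
    have hnv₀ : n *ᵥ v₀ = 0 := by
      rw [hv₀e]
      funext i
      have h := congrFun (congrFun hn2 i) j₀
      rw [Matrix.mul_apply] at h
      exact h
    have hu := form_mulVec_eq_of_mem_unitaryGroup σ hγ
    rw [hγn] at hu
    have hiso := Literature.LinearAlgebra.HermitianPlane.form_eq_zero_of_unitary_transvection σ hσσ c hn hn2 hu hv₀ hnv₀
    rw [map_one, mul_one, mul_one] at hiso
    obtain ⟨g₀, hg₀det, hg₀form, hg₀col⟩ : ∃ g₀ : Matrix (Fin 2) (Fin 2) K, g₀.det ≠ 0 ∧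
        (g₀.map σ)ᵀ * (Matrix.of fun i j : Fin 2 => if i.val + j.val + 1 = 2 then (1 : K) else 0) * g₀ =
          (Matrix.of fun i j : Fin 2 => if i.val + j.val + 1 = 2 then (1 : K) else 0) ∧ g₀ *ᵥ ![1, 0] = v₀ := by
      rcases eq_or_ne (v₀ 1) 0 with hq | hq
      · have hp : v₀ 0 ≠ 0 := fun hp => hv₀ (by
          funext i
          fin_cases i
          · exact hp
          · exact hq)
        have hσp : σ (v₀ 0) ≠ 0 := (map_ne_zero σ).2 hp
        refine ⟨!![v₀ 0, 0; 0, (σ (v₀ 0))⁻¹], ?_, ?_, ?_⟩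
        · rw [Matrix.det_fin_two_of, zero_mul, sub_zero]
          exact mul_ne_zero hp (inv_ne_zero hσp)
        · ext i j
          fin_cases i <;> fin_cases j <;> simp [Matrix.mul_apply, Fin.sum_univ_two, hσσ, hp, hσp]
        · funext i
          fin_cases i
          · simp [Matrix.mulVec, dotProduct, Fin.sum_univ_two]
          · simp [Matrix.mulVec, dotProduct, Fin.sum_univ_two, hq]
      · have hσq : σ (v₀ 1) ≠ 0 := (map_ne_zero σ).2 hq
        have hq0 : σ (v₀ 1) * v₀ 0 = -(σ (v₀ 0) * v₀ 1) := by linear_combination hiso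
        refine ⟨!![v₀ 0, (σ (v₀ 1))⁻¹; v₀ 1, 0], ?_, ?_, ?_⟩
        · rw [Matrix.det_fin_two_of, mul_zero, zero_sub, neg_ne_zero]
          exact mul_ne_zero (inv_ne_zero hσq) hq
        · ext i j
          fin_cases i <;> fin_cases j <;> simp [Matrix.mul_apply, Fin.sum_univ_two, hσσ, hq, hσq, hq0]
        · funext i
          fin_cases i <;> simp [Matrix.mulVec, dotProduct, Fin.sum_univ_two]
    obtain ⟨G₀, hG₀⟩ : ∃ G : GL (Fin 2) K, (G : Matrix (Fin 2) (Fin 2) K) = g₀ :=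
      ⟨Matrix.GeneralLinearGroup.mkOfDetNeZero g₀ hg₀det, Matrix.GeneralLinearGroup.val_mkOfDetNeZero _ _⟩
    have hXg : ((G₀⁻¹ : GL (Fin 2) K) : Matrix (Fin 2) (Fin 2) K) * g₀ = 1 := by
      rw [← hG₀, ← Units.val_mul, inv_mul_cancel, Units.val_one]
    have hgX : g₀ * ((G₀⁻¹ : GL (Fin 2) K) : Matrix (Fin 2) (Fin 2) K) = 1 := by
      rw [← hG₀, ← Units.val_mul, mul_inv_cancel, Units.val_one]
    obtain ⟨n', hn'⟩ : ∃ n' : Matrix (Fin 2) (Fin 2) K, n' = ((G₀⁻¹ : GL (Fin 2) K) : Matrix (Fin 2) (Fin 2) K) * n * g₀ := ⟨_, rfl⟩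
    have hconj : (((G₀⁻¹ * γ * G₀ : GL (Fin 2) K)) : Matrix (Fin 2) (Fin 2) K) = c • (1 : Matrix (Fin 2) (Fin 2) K) + n' := by
      rw [Units.val_mul, Units.val_mul, hγn, hG₀, Matrix.mul_add, Matrix.add_mul, Matrix.mul_smul, Matrix.mul_one, Matrix.smul_mul, hXg, hn']
    have hn'2 : n' * n' = 0 := by
      rw [hn']
      calc ((G₀⁻¹ : GL (Fin 2) K) : Matrix (Fin 2) (Fin 2) K) * n * g₀ * (((G₀⁻¹ : GL (Fin 2) K) : Matrix (Fin 2) (Fin 2) K) * n * g₀)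
          = ((G₀⁻¹ : GL (Fin 2) K) : Matrix (Fin 2) (Fin 2) K) * (n * ((g₀ * ((G₀⁻¹ : GL (Fin 2) K) : Matrix (Fin 2) (Fin 2) K)) * n)) * g₀ := by
            simp only [Matrix.mul_assoc]
        _ = 0 := by rw [hgX, Matrix.one_mul, hn2, Matrix.mul_zero, Matrix.zero_mul]
    have hn'v : n' *ᵥ ![1, 0] = 0 := by
      rw [hn', ← Matrix.mulVec_mulVec, ← Matrix.mulVec_mulVec, hg₀col, hnv₀, Matrix.mulVec_zero]
    have hcol : ∀ i, n' i 0 = 0 := fun i => by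
      have h := congrFun hn'v i
      simpa [Matrix.mulVec, dotProduct, Fin.sum_univ_two] using h
    have h11 : n' 1 1 = 0 := by
      have h := congrFun (congrFun hn'2 1) 1
      rw [Matrix.mul_apply, Fin.sum_univ_two, hcol 1, zero_mul, zero_add, Matrix.zero_apply] at h
      exact mul_self_eq_zero.1 h
    have hM₁ : c • (1 : Matrix (Fin 2) (Fin 2) K) + n' = !![c, n' 0 1; 0, c] := by
      ext i j
      fin_cases i <;> fin_cases j <;> simp [hcol 0, hcol 1, h11]
    obtain ⟨k, hk⟩ : ∃ k : ℕ, ϖ ^ k * n' 0 1 * ϖ ^ k ∈ 𝒪[K] := by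
      rcases eq_or_ne (n' 0 1) 0 with hx | hx
      · exact ⟨0, by rw [hx, mul_zero, zero_mul]; exact (𝒪[K]).zero_mem⟩
      · obtain ⟨m, hm⟩ := exists_valuation_eq_valuation_zpow hϖ hx
        refine ⟨m.natAbs, (Valuation.mem_integer_iff _ _).2 ?_⟩
        rw [map_mul, map_mul, hm, ← map_mul, ← map_mul, ← zpow_natCast, ← zpow_add₀ hϖ0, ← zpow_add₀ hϖ0]
        exact (Valuation.mem_integer_iff _ _).1 ((zpow_uniformizer_mem_integer_iff hϖ _).2 (by omega))
    obtain ⟨π, hπ⟩ : ∃ π : K, π = ϖ ^ k := ⟨_, rfl⟩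
    rw [← hπ] at hk
    have hπ0 : π ≠ 0 := by rw [hπ]; exact pow_ne_zero k hϖ0
    have hσπ : σ π = π := by rw [hπ, map_pow, hσϖ]
    have hDdet : (diagonal ![π⁻¹, π]).det ≠ 0 := by
      rw [det_diagonal, Fin.prod_univ_two]
      simp [hπ0]
    obtain ⟨D, hD⟩ : ∃ D : GL (Fin 2) K, (D : Matrix (Fin 2) (Fin 2) K) = diagonal ![π⁻¹, π] :=
      ⟨Matrix.GeneralLinearGroup.mkOfDetNeZero _ hDdet, Matrix.GeneralLinearGroup.val_mkOfDetNeZero _ _⟩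
    have hDinv : ((D⁻¹ : GL (Fin 2) K) : Matrix (Fin 2) (Fin 2) K) = diagonal ![π, π⁻¹] := by
      rw [Matrix.coe_units_inv, hD]
      refine Matrix.inv_eq_left_inv ?_
      rw [diagonal_mul_diagonal]
      ext i j
      fin_cases i <;> fin_cases j <;> simp [hπ0]
    refine ⟨G₀ * D, ?_, ?_⟩
    · rw [formCongr_mul]
      show (((D : Matrix (Fin 2) (Fin 2) K)).map σ)ᵀ *
          ((((G₀ : Matrix (Fin 2) (Fin 2) K)).map σ)ᵀ * (Matrix.of fun i j : Fin 2 => if i.val + j.val + 1 = 2 then (1 : K) else 0) *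
            (G₀ : Matrix (Fin 2) (Fin 2) K)) * (D : Matrix (Fin 2) (Fin 2) K) = _
      rw [hG₀, hg₀form, hD, diagonal_map (map_zero σ), diagonal_transpose]
      ext i j
      fin_cases i <;> fin_cases j <;> simp [Matrix.mul_apply, Fin.sum_univ_two, hσπ, hπ0]
    · have hval : (((G₀ * D)⁻¹ * γ * (G₀ * D) : GL (Fin 2) K) : Matrix (Fin 2) (Fin 2) K) = !![c, π * n' 0 1 * π; 0, c] := by
        rw [show (G₀ * D)⁻¹ * γ * (G₀ * D) = D⁻¹ * (G₀⁻¹ * γ * G₀) * D by group, Units.val_mul, Units.val_mul, hconj, hM₁, hDinv, hD]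
        have h1 : ∀ y, π * y * π⁻¹ = y := fun y => by rw [mul_comm π y, mul_inv_cancel_right₀ hπ0]
        have h2 : ∀ y, π⁻¹ * y * π = y := fun y => by rw [mul_comm π⁻¹ y, inv_mul_cancel_right₀ hπ0]
        ext i j
        fin_cases i <;> fin_cases j <;> simp [Matrix.mul_apply, Fin.sum_univ_two, h1, h2]
      refine mem_glInt_of_isIntegralMatrix (fun i j => ?_) ?_
      · rw [hval]
        fin_cases i <;> fin_cases j
        · exact hcO
        · exact hk
        · exact (𝒪[K]).zero_mem
        · exact hcO
      · rw [hval, Matrix.det_fin_two_of, mul_zero, sub_zero, map_mul, hc, mul_one]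

include hϖ in
/-- **THE DOUBLE ROOT.**  `γ ∈ U(σ, Φ₂)`, `|det γ| = 1`, `χ_γ` with a root but NOT separable: `χ_γ = (X − α)²`, `|α| = 1`, `(γ − α)² = 0` (Cayley–Hamilton) — a scalar or
a unitary transvection, hence fixes a self-dual vertex. [cite: Serre1980Trees, Ch. II §1.3] [cite: Rogawski1990, §12.6 p. 174] -/
theorem exists_formCongr_eq_and_mem_glInt_of_not_separable [IsDiscreteValuationRing 𝒪[K]] (hσσ : ∀ x, σ (σ x) = x) (hσϖ : σ ϖ = ϖ)
    {γ : GL (Fin 2) K} (hγ : γ ∈ unitaryGroup σ (Matrix.of fun i j : Fin 2 => if i.val + j.val + 1 = 2 then (1 : K) else 0))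
    (hdet : valuation K (γ : Matrix (Fin 2) (Fin 2) K).det = 1) {α : K} (hα : ((γ : Matrix (Fin 2) (Fin 2) K).charpoly).IsRoot α)
    (hsep : ¬ ((γ : Matrix (Fin 2) (Fin 2) K).charpoly).Separable) :
    ∃ g : GL (Fin 2) K, formCongr σ g (Matrix.of fun i j : Fin 2 => if i.val + j.val + 1 = 2 then (1 : K) else 0) =
        (Matrix.of fun i j : Fin 2 => if i.val + j.val + 1 = 2 then (1 : K) else 0) ∧ g⁻¹ * γ * g ∈ glInt 2 K := by
  obtain ⟨α', hfac⟩ := UnitaryGroup.exists_eq_X_sub_C_mul_X_sub_C_of_isRoot (Matrix.charpoly_monic _)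
    (by rw [Matrix.charpoly_natDegree_eq_dim, Fintype.card_fin]) hα
  have hαα' : α = α' := by
    by_contra hne
    exact hsep (by
      rw [hfac]
      exact Polynomial.separable_X_sub_C.mul Polynomial.separable_X_sub_C
        (Polynomial.isCoprime_X_sub_C_of_isUnit_sub (sub_ne_zero.2 hne).isUnit))
  subst hαα'
  have hdetα : (γ : Matrix (Fin 2) (Fin 2) K).det = α * α := by
    rw [Matrix.det_eq_sign_charpoly_coeff, hfac, Fintype.card_fin, Polynomial.mul_coeff_zero]
    simp
  have hαv : valuation K α = 1 := valuation_eq_one_of_mul_self_eq hdetα.symm hdet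
  have hCH : ((γ : Matrix (Fin 2) (Fin 2) K) - α • 1) * ((γ : Matrix (Fin 2) (Fin 2) K) - α • 1) = 0 := by
    have h := Matrix.aeval_self_charpoly (γ : Matrix (Fin 2) (Fin 2) K)
    rwa [hfac, map_mul, map_sub, Polynomial.aeval_X, Polynomial.aeval_C, Algebra.algebraMap_eq_smul_one] at h
  exact exists_formCongr_eq_and_mem_glInt_of_mul_self_eq_zero σ hϖ hσσ hσϖ hγ hαv hCH (add_sub_cancel _ _).symm

end Vertex

/-! ## §4 At the CM place `w`: every compact element of `U(Φ₂)(L⁺_v)` fixes a vertex lattice -/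

namespace UnitaryGroup

open Literature.NumberTheory.Rogawski1990 Literature.NumberTheory.GaloisRepresentations

section CM

variable (L : Type) [Field L] [NumberField L] [IsCMField L] (v : HeightOneSpectrum (𝓞 ↥(maximalRealSubfield L)))
  (w : PlacesOver L v) (hw : IsCMField.complexConj L • w.1 = w.1)

omit [IsCMField L] in
/-- `(Φ₂)_w = placeForm Φ₂ w` is the antidiagonal literal over `L_w` (★ `placeForm_antidiagOne`, `antidiagOne_eq_over`). [cite: Rogawski1990, §3.5 p. 29] -/
private theorem placeForm_antidiagTwo_eq_literal :
    placeForm (Matrix.of fun i j : Fin 2 => if i.val + j.val + 1 = 2 then (1 : L) else 0) w.1 =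
      Matrix.of fun i j : Fin 2 => if i.val + j.val + 1 = 2 then (1 : w.1.adicCompletion L) else 0 := by
  rw [placeForm_antidiagOne, ← antidiagOne_eq_over]

include hw in
/-- **COMPACT ELEMENTS FIX A VERTEX (I-5a).**  At a place `v` non-split and unramified in the CM field `L`, every `γ ∈ U(σ_w, (Φ₂)_w)(L_w)` with INTEGRAL TRACE stabilises
a vertex lattice: `∃ g ∈ GL₂(L_w)`, `e ∈ {0, 1}`, `J′ ∈ GL₂(𝒪_w)` with `ϖ_w^e • ↑J′ = ᵗσ_w(g) (Φ₂)_w g` (`e = 0` self-dual, `e = 1` `ϖ`-modular; `ϖ_w = ι_w(ϖ_v)`) and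
`g⁻¹ γ g ∈ GL₂(𝒪_w)`.  Proof: the trichotomy of `χ_γ` over `L_w` (module docstring). [cite: Kottwitz1988, §2] [cite: Serre1980Trees, Ch. II §1.3] [cite: Rogawski1990, §4.9 Lemma 4.9.3 p. 61] -/
theorem exists_vertexFrame_of_trace_mem (hunr : Algebra.IsUnramifiedIn (𝓞 L) v.asIdeal) (γ : GL (Fin 2) (w.1.adicCompletion L))
    (hγ : γ ∈ Literature.AlgebraicGeometry.ShimuraVarieties.unitaryGroup (galAdicCompletionMap (L := L) (IsCMField.complexConj L) hw)
      (placeForm (Matrix.of fun i j : Fin 2 => if i.val + j.val + 1 = 2 then (1 : L) else 0) w.1))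
    (htr : ((γ : Matrix (Fin 2) (Fin 2) (w.1.adicCompletion L))).trace ∈ 𝒪[w.1.adicCompletion L]) :
    ∃ (g : GL (Fin 2) (w.1.adicCompletion L)) (e : ℕ), e ≤ 1 ∧
      (∃ J' ∈ glInt 2 (w.1.adicCompletion L),
        (toPlace v w (HeckeCharacter.uniformizer ↥(maximalRealSubfield L) v : v.adicCompletion ↥(maximalRealSubfield L))) ^ e •
            (J' : Matrix (Fin 2) (Fin 2) (w.1.adicCompletion L)) =
          formCongr (galAdicCompletionMap (L := L) (IsCMField.complexConj L) hw) g
            (placeForm (Matrix.of fun i j : Fin 2 => if i.val + j.val + 1 = 2 then (1 : L) else 0) w.1)) ∧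
      g⁻¹ * γ * g ∈ glInt 2 (w.1.adicCompletion L) := by
  classical
  have hc1 : IsCMField.complexConj L ≠ 1 := IsCMField.complexConj_ne_one L
  have hσσ : ∀ x, galAdicCompletionMap (L := L) (IsCMField.complexConj L) hw (galAdicCompletionMap (L := L) (IsCMField.complexConj L) hw x) = x :=
    galAdicCompletionMap_galAdicCompletionMap_of_smul_eq (IsCMField.complexConj L) w hc1 hw
  have hϖv := valued_toPlace_uniformizer L v w hunr
  have hϖ : IsUniformizingElement (toPlace v w (HeckeCharacter.uniformizer ↥(maximalRealSubfield L) v : v.adicCompletion ↥(maximalRealSubfield L))) :=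
    isUniformizingElement_of_v_eq hϖv
  haveI : IsDiscreteValuationRing 𝒪[w.1.adicCompletion L] := isDiscreteValuationRing_integer_of_compatible hϖv
  have hσϖ := galAdicCompletionMap_toPlace_self L v w hw (HeckeCharacter.uniformizer ↥(maximalRealSubfield L) v : v.adicCompletion ↥(maximalRealSubfield L))
  have hσv : ∀ x : w.1.adicCompletion L, valuation (w.1.adicCompletion L) (galAdicCompletionMap (L := L) (IsCMField.complexConj L) hw x) =
      valuation (w.1.adicCompletion L) x := fun x => valuation_galAdicCompletionMap_eq (IsCMField.complexConj L) v w hw x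
  have hJ := det_placeForm_antidiagTwo_ne_zero_and_even L v w
  have hdetv : valuation (w.1.adicCompletion L) (γ : Matrix (Fin 2) (Fin 2) (w.1.adicCompletion L)).det = 1 :=
    valuation_eq_one_of_galAdicCompletionMap_mul_self L v w hw (map_det_mul_det_eq_one_of_mem_unitaryGroup _ hJ.1 hγ)
  have htrv : valuation (w.1.adicCompletion L) (γ : Matrix (Fin 2) (Fin 2) (w.1.adicCompletion L)).trace ≤ 1 := (Valuation.mem_integer_iff _ _).1 htr
  have hlit := placeForm_antidiagTwo_eq_literal L v w
  rcases em (∃ x : w.1.adicCompletion L, ((γ : Matrix (Fin 2) (Fin 2) (w.1.adicCompletion L)).charpoly).IsRoot x) with ⟨α, hα⟩ | hroot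
  · rcases em ((γ : Matrix (Fin 2) (Fin 2) (w.1.adicCompletion L)).charpoly.Separable) with hsep | hsep
    · -- DISTINCT roots: an eigenframe with unit eigenvalues
      obtain ⟨P, u, hP, hu, -⟩ := exists_eigenframe_of_isRoot_of_separable γ hα hsep
      have huv : ∀ i, valuation (w.1.adicCompletion L) (u i) = 1 := valuation_eq_one_of_eigenframe P hP htrv hdetv
      rcases eq_or_ne (galAdicCompletionMap (L := L) (IsCMField.complexConj L) hw (u 0) * u 0) 1 with hN | hN
      · -- type (1): both of norm one (★ `map_mul_self_eq_one_iff_of_eigenframe`); ★ (L5-d1) rescaling, Gram `ϖ^e • 1`, element `diag(u)`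
        have hu1 : ∀ i, galAdicCompletionMap (L := L) (IsCMField.complexConj L) hw (u i) * u i = 1 :=
          Fin.forall_fin_two.2 ⟨hN, (map_mul_self_eq_one_iff_of_eigenframe _ (isUnit_iff_ne_zero.2 hJ.1) hγ hP).1 hN⟩
        obtain ⟨c, D, e, hD, he1, -, hform⟩ := exists_rescaling_formCongr_eq_uniformizer_pow_smul_one L v w hw hunr (placeForm_antidiagTwo_hermitian L v w hw)
          hJ.1 hJ.2 hγ hP hu hu1
        refine ⟨P * D, e, he1, ⟨1, Subgroup.one_mem _, by rw [Units.val_one, hform]⟩, ?_⟩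
        exact mem_glInt_of_coe_eq_diagonal_of_valuation_eq_one (inv_mul_mul_eq_diagonal_of_eigenframe γ P D hP hD) huv
      · -- split torus: Gram `Φ₂` itself, `e = 0`
        obtain ⟨g, hg, hgi⟩ := exists_formCongr_eq_antidiag_and_mem_glInt_of_not_normOne _ hσσ (placeForm_antidiagTwo_hermitian L v w hw) hJ.1 hγ hP hu hN huv
        obtain ⟨J', hJ', hJ'e⟩ := exists_mem_glInt_coe_eq_antidiag (K := w.1.adicCompletion L)
        exact ⟨g, 0, zero_le_one, ⟨J', hJ', by rw [pow_zero, one_smul, hJ'e, hg]⟩, hgi⟩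
    · -- DOUBLE root: scalar or unitary transvection, `e = 0`
      rw [hlit] at hγ
      obtain ⟨g, hg, hgi⟩ := exists_formCongr_eq_and_mem_glInt_of_not_separable _ hϖ hσσ hσϖ hγ hdetv hα hsep
      obtain ⟨J', hJ', hJ'e⟩ := exists_mem_glInt_coe_eq_antidiag (K := w.1.adicCompletion L)
      exact ⟨g, 0, zero_le_one, ⟨J', hJ', by rw [pow_zero, one_smul, hJ'e, hlit, hg]⟩, hgi⟩
  · -- NO root: ★ cyclic frame (β0′); the companion matrix is integral; Gram `antidiag(β, σβ)`, `|β| = |ϖ^e|`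
    obtain ⟨P, γ', β, e, -, he1, hγ', hcomp, hform, hval, -, -⟩ := exists_cyclicFrame_ncard_selfDualStable_eq L v w hw hunr γ hγ hroot
    obtain ⟨J', hJ', hJ'e⟩ := exists_mem_glInt_smul_coe_eq_antidiag _ hσv hσϖ hϖ.ne_zero ((v_eq_iff_valuation_eq _ _).1 hval)
    refine ⟨P, e, he1, ⟨J', hJ', by rw [hJ'e, hform]⟩, ?_⟩
    rw [← hγ']
    exact mem_glInt_of_coe_eq_companion hcomp htr hdetv

include hw in
/-- **The lattice spelling**: `γ` with `tr γ ∈ 𝒪_w` STABILISES a vertex lattice `Λ(g)` (`𝒪_w`-span of the columns of `g`, `ϖ_w^e`-modular, `e ∈ {0, 1}`):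
`γ · Λ(g) = Λ(g)` (★ `map_span_range_transpose_eq_self_iff`). [cite: Kottwitz1988, §2] [cite: Serre1980Trees, Ch. II §1.3] -/
theorem exists_vertexLattice_map_eq_self_of_trace_mem (hunr : Algebra.IsUnramifiedIn (𝓞 L) v.asIdeal) (γ : GL (Fin 2) (w.1.adicCompletion L))
    (hγ : γ ∈ Literature.AlgebraicGeometry.ShimuraVarieties.unitaryGroup (galAdicCompletionMap (L := L) (IsCMField.complexConj L) hw)
      (placeForm (Matrix.of fun i j : Fin 2 => if i.val + j.val + 1 = 2 then (1 : L) else 0) w.1))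
    (htr : ((γ : Matrix (Fin 2) (Fin 2) (w.1.adicCompletion L))).trace ∈ 𝒪[w.1.adicCompletion L]) :
    ∃ (g : GL (Fin 2) (w.1.adicCompletion L)) (e : ℕ), e ≤ 1 ∧
      (∃ J' ∈ glInt 2 (w.1.adicCompletion L),
        (toPlace v w (HeckeCharacter.uniformizer ↥(maximalRealSubfield L) v : v.adicCompletion ↥(maximalRealSubfield L))) ^ e •
            (J' : Matrix (Fin 2) (Fin 2) (w.1.adicCompletion L)) =
          formCongr (galAdicCompletionMap (L := L) (IsCMField.complexConj L) hw) g
            (placeForm (Matrix.of fun i j : Fin 2 => if i.val + j.val + 1 = 2 then (1 : L) else 0) w.1)) ∧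
      (Submodule.span 𝒪[w.1.adicCompletion L] (Set.range ((g : Matrix (Fin 2) (Fin 2) (w.1.adicCompletion L)))ᵀ)).map
          ((Matrix.toLin' (γ : Matrix (Fin 2) (Fin 2) (w.1.adicCompletion L))).restrictScalars 𝒪[w.1.adicCompletion L]) =
        Submodule.span 𝒪[w.1.adicCompletion L] (Set.range ((g : Matrix (Fin 2) (Fin 2) (w.1.adicCompletion L)))ᵀ) := by
  obtain ⟨g, e, he1, hJ', hγg⟩ := exists_vertexFrame_of_trace_mem L v w hw hunr γ hγ htr
  exact ⟨g, e, he1, hJ', (map_span_range_transpose_eq_self_iff γ g).2 hγg⟩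

include hw in
/-- **THE FIRST COLOUR, group currency** (mirror of ★ `exists_eq_mul_mul_inv_of_modular_antidiagTwo`): on `U = ↥U(σ_w, (Φ₂)_w)(L_w)` with `K⁰ := (glInt 2 L_w).subgroupOf U`,
every `γ ∈ U` fixing a SELF-DUAL lattice `Λ(g)` is `y k y⁻¹`, `y : U`, `k ∈ K⁰` (★ `exists_mem_unitaryGroupOfForm_mul_of_selfDual_of_nonsplit`: `g = u k₀`). [cite: Kottwitz1988, §2]
[cite: Jacobowitz1962, §7 Thm. 7.1] -/
theorem exists_eq_mul_mul_inv_of_selfDual_antidiagTwo (hunr : Algebra.IsUnramifiedIn (𝓞 L) v.asIdeal) (g : GL (Fin 2) (w.1.adicCompletion L))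
    (hg : ∃ J' ∈ glInt 2 (w.1.adicCompletion L), (J' : Matrix (Fin 2) (Fin 2) (w.1.adicCompletion L)) =
      formCongr (galAdicCompletionMap (L := L) (IsCMField.complexConj L) hw) g
        (placeForm (Matrix.of fun i j : Fin 2 => if i.val + j.val + 1 = 2 then (1 : L) else 0) w.1))
    (γ : ↥(Literature.AlgebraicGeometry.ShimuraVarieties.unitaryGroup (galAdicCompletionMap (L := L) (IsCMField.complexConj L) hw)
      (placeForm (Matrix.of fun i j : Fin 2 => if i.val + j.val + 1 = 2 then (1 : L) else 0) w.1)))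
    (hγg : g⁻¹ * (γ : GL (Fin 2) (w.1.adicCompletion L)) * g ∈ glInt 2 (w.1.adicCompletion L)) :
    ∃ y : ↥(Literature.AlgebraicGeometry.ShimuraVarieties.unitaryGroup (galAdicCompletionMap (L := L) (IsCMField.complexConj L) hw)
        (placeForm (Matrix.of fun i j : Fin 2 => if i.val + j.val + 1 = 2 then (1 : L) else 0) w.1)),
      ∃ k ∈ (glInt 2 (w.1.adicCompletion L)).subgroupOf
        (Literature.AlgebraicGeometry.ShimuraVarieties.unitaryGroup (galAdicCompletionMap (L := L) (IsCMField.complexConj L) hw)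
          (placeForm (Matrix.of fun i j : Fin 2 => if i.val + j.val + 1 = 2 then (1 : L) else 0) w.1)),
      γ = y * k * y⁻¹ := by
  have hJ := unit_placeForm_antidiagOne_mem_glInt (E := L) 2 w.1
  have hcoe : (((isUnit_placeForm_antidiagOne (E := L) 2 w.1).unit : GL (Fin 2) (w.1.adicCompletion L)) :
      Matrix (Fin 2) (Fin 2) (w.1.adicCompletion L)) =
      placeForm (Matrix.of fun i j : Fin 2 => if i.val + j.val + 1 = 2 then (1 : L) else 0) w.1 := IsUnit.unit_spec _
  have hJh := placeForm_antidiagTwo_hermitian L v w hw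
  rw [← hcoe] at hJh hg
  obtain ⟨u, hu, k, hk, rfl⟩ := exists_mem_unitaryGroupOfForm_mul_of_selfDual_of_nonsplit (IsCMField.complexConj L) w (IsCMField.complexConj_ne_one L) hw
    hunr _ hJ hJh g hg
  have hu' : u ∈ Literature.AlgebraicGeometry.ShimuraVarieties.unitaryGroup (galAdicCompletionMap (L := L) (IsCMField.complexConj L) hw)
      (placeForm (Matrix.of fun i j : Fin 2 => if i.val + j.val + 1 = 2 then (1 : L) else 0) w.1) := hu
  refine ⟨⟨u, hu'⟩, ⟨u, hu'⟩⁻¹ * γ * ⟨u, hu'⟩, ?_, ?_⟩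
  · rw [Subgroup.mem_subgroupOf]
    have h : u⁻¹ * (γ : GL (Fin 2) (w.1.adicCompletion L)) * u =
        k * ((u * k)⁻¹ * (γ : GL (Fin 2) (w.1.adicCompletion L)) * (u * k)) * k⁻¹ := by group
    show u⁻¹ * (γ : GL (Fin 2) (w.1.adicCompletion L)) * u ∈ glInt 2 (w.1.adicCompletion L)
    rw [h]
    exact mul_mem (mul_mem hk hγg) (inv_mem hk)
  · group

include hw in
/-- **SUPPORT LOCALISATION ON THE CARRIER `U = ↥U(σ_w, (Φ₂)_w)(L_w)` (I-5a, A-8 (d)): `{γ ∈ U | tr γ ∈ 𝒪_w} ⊆ ⋃_y y K⁰ y⁻¹ ∪ ⋃_y y K¹ y⁻¹`**, `K⁰ := GL₂(𝒪_w) ⊓ U`,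
`K¹ := (diag(1, ϖ_w) GL₂(𝒪_w) diag(1, ϖ_w)⁻¹) ⊓ U` (★ `K′`-token `(glInt 2).map (MulAut.conj S)`); the `e = 1` colour is ★ `exists_eq_mul_mul_inv_of_modular_antidiagTwo`.
[cite: Kottwitz1988, §2] [cite: Serre1980Trees, Ch. II §1.3] [cite: Rogawski1990, §4.9 Lemma 4.9.3 p. 61] -/
theorem exists_eq_mul_mul_inv_or_of_trace_mem (hunr : Algebra.IsUnramifiedIn (𝓞 L) v.asIdeal)
    (γ : ↥(Literature.AlgebraicGeometry.ShimuraVarieties.unitaryGroup (galAdicCompletionMap (L := L) (IsCMField.complexConj L) hw)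
      (placeForm (Matrix.of fun i j : Fin 2 => if i.val + j.val + 1 = 2 then (1 : L) else 0) w.1)))
    (htr : (((γ : GL (Fin 2) (w.1.adicCompletion L)) : Matrix (Fin 2) (Fin 2) (w.1.adicCompletion L))).trace ∈ 𝒪[w.1.adicCompletion L]) :
    (∃ y : ↥(Literature.AlgebraicGeometry.ShimuraVarieties.unitaryGroup (galAdicCompletionMap (L := L) (IsCMField.complexConj L) hw)
        (placeForm (Matrix.of fun i j : Fin 2 => if i.val + j.val + 1 = 2 then (1 : L) else 0) w.1)),
      ∃ k ∈ (glInt 2 (w.1.adicCompletion L)).subgroupOf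
        (Literature.AlgebraicGeometry.ShimuraVarieties.unitaryGroup (galAdicCompletionMap (L := L) (IsCMField.complexConj L) hw)
          (placeForm (Matrix.of fun i j : Fin 2 => if i.val + j.val + 1 = 2 then (1 : L) else 0) w.1)),
      γ = y * k * y⁻¹) ∨
    (∃ y : ↥(Literature.AlgebraicGeometry.ShimuraVarieties.unitaryGroup (galAdicCompletionMap (L := L) (IsCMField.complexConj L) hw)
        (placeForm (Matrix.of fun i j : Fin 2 => if i.val + j.val + 1 = 2 then (1 : L) else 0) w.1)),
      ∃ k ∈ ((glInt 2 (w.1.adicCompletion L)).map (MulAut.conj (glDiagonal 2 (w.1.adicCompletion L)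
          ![1, Units.mk0 (toPlace v w (HeckeCharacter.uniformizer ↥(maximalRealSubfield L) v : v.adicCompletion ↥(maximalRealSubfield L)))
            (toPlace_uniformizer_ne_zero L v w hunr)])).toMonoidHom).subgroupOf
        (Literature.AlgebraicGeometry.ShimuraVarieties.unitaryGroup (galAdicCompletionMap (L := L) (IsCMField.complexConj L) hw)
          (placeForm (Matrix.of fun i j : Fin 2 => if i.val + j.val + 1 = 2 then (1 : L) else 0) w.1)),
      γ = y * k * y⁻¹) := by
  obtain ⟨g, e, he1, ⟨J', hJ', hJ'e⟩, hγg⟩ := exists_vertexFrame_of_trace_mem L v w hw hunr γ γ.2 htr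
  rcases Nat.le_one_iff_eq_zero_or_eq_one.1 he1 with rfl | rfl
  · left
    exact exists_eq_mul_mul_inv_of_selfDual_antidiagTwo L v w hw hunr g ⟨J', hJ', by rw [← hJ'e, pow_zero, one_smul]⟩ γ hγg
  · right
    exact exists_eq_mul_mul_inv_of_modular_antidiagTwo L v w hw hunr g ⟨J', hJ', by rw [← hJ'e, pow_one]⟩ γ hγg

end CM

end UnitaryGroup

end Literature.NumberTheory.Automorphic

end
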